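import Summits.ResolutionOfSingularities.ResolutionOfSingularities.Theorems.FreezeCutClasses
import Summits.ResolutionOfSingularities.ResolutionOfSingularities.Theorems.ItineraryCutClasses
import Literature.AlgebraicGeometry.Resolution.PointBlowupMohBound
import HarnessLib

/-!
# PollutionLaw — decomp-res node «WallCut» (lens-3 g21, critic row 158), tree file 3/5 of the node

Content VERBATIM from the decomp-res lens-3 g21 node `HOME/decomp-res-lens-3/g21/WallCut.lean` (pin 1e528a76 =
`parts/…` of HOME/decomp-res-lens-3/g21, 2 135 l; HOME = run/shared/lean/pub/decomp-res; lens imports = tree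
`MaxContactCutFreezeCut` +
`StallVertexStraightClasses` only; rc 0 · 0 sorry): its NEW PART ONLY, §W1–§W4 (l. 1330–2120) — the carried block l.
65–1328 (= g20
`ExtinctionCut` c917c20b l. 48–1308, code VERBATIM) is ALREADY in the tree as `FreezeCutDead` · `FreezeCutDead2` ·
`FreezeCutDeadClasses` ·
`MaxContactCutFreezeCutDead` · `ExtinctionCutToric` · `ExtinctionCutToric2` · `ExtinctionCutPort` ·
`MaxContactCutExtinctionCut` and is imported, not
repeated.  Critic: CRITIC-LEDGER row 158 (2026-08-31T00:37:25Z): 0 · 0 — BOOKED with CONVERSION RESERVED («true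
kernel content, land as support»:
THE WALL LAW pins the multiplicities, THE POLLUTION LAW kills the cleaning deficiency, the closing step is the ONE
port at generality δ).  Landing
orders INBOX :569 (lens-3 g21 landing note) and :577 (critic): `--kind proof --supports stmt-ResolutionOfSingularities-31770`
(`MaxContactCut.DefectWalksDeep`); files of the node, in import order: `WallLaw` / `WallLaw2` (§W1, kernel,
namespace `…Theorems.WallCut`, over the
in-cone `FreezeCutDead2` + the toric kernel `ExtinctionCutToric2`) · `PollutionLaw` (§W2, model level, cone-free) ·
`WallCutClasses` (§W3 the ONE typed
port `BalancedWallPort` with `kollarWallPort_of_balancedWallPort`, and the three §W4 classes; cone-free so that the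
route file can cite the port as an
item) · `MaxContactCutWallCut` (§W4 kernels and EXACT iff's at 31770, Theses cone; §M `closes` = tree
`MaxContactCutExponentLadder.closes` verbatim is
omitted, as in `MaxContactCutFreezeCut`).  Aside bookkeeping (rows 156 / 158, INBOX :552 / :577): on the lens-3
column ONE typed PORT item
`WallCut.BalancedWallPort` (g20's `ExtinctionCut.KollarWallPort` is DERIVED from it) and ONE live aside
`FreezeCut.NoSmallDeadStrictHighSkewJointTailsDeep`
(home `FreezeCutDeadClasses`; mod-port reading LOSSY ∧ WILD-BALANCED, `smallDeadStrict_iff_lossy_wild_of_port`);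
decided-mod-port cells are not filed.

## This file

§W2 THE POLLUTION LAW (NEW, KERNEL, model level, cone-free): **`walk_pollution_balanced`** — on a δ-balanced stage
the deleted `q`-th-power exponents satisfy `E_y ≥ r′_y + s` at every wall, i.e. the cleaning term is divisible by
the new exceptional monomial `(u′v′)^{q}` — the port's pollution obligation DISCHARGED in every cell (`q − δ = s`).
Imports `FreezeCutClasses` + `ItineraryCutClasses` (the walk ledger `walk_nat` / `walk_r`) + `Literature…PointBlowupMohBound`.

[WRITER NOTE (decomp-res writer g9): file split only (tree files ≤ 400 lines); namespaces, sections, section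
variables and every declaration
exactly as in the lens (the lens's global opens are replayed per file; cone-free files carry the opens of
`FreezeCutClasses.lean`).]

(Sources: Kollar2007 (Lectures on Resolution of Singularities: Thm 1.93, Def 2.56, Rem 2.57, Claim 2.59.1, (2.59.2),
Claim 2.59.4) [corpus:book:kollar2007-lectures-resolution-singularities pp. 54, 92–94]; ZariskiSamuel1960 vol. II
ch. VII §1 Thm 5; CossartJannsenSaito2009 (arXiv:0905.2191 §2); Hauser2010Kangaroo (arXiv:0811.4151); Moh1987;
CossartPiltant2008 §2.)
-/

noncomputable section

open MvPolynomial Finset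
open Literature.AlgebraicGeometry.Resolution
open Literature.AlgebraicGeometry.Resolution.Hauser2010
open Literature.AlgebraicGeometry.Resolution.PointBlowup
open Literature.AlgebraicGeometry.Resolution.WeightedBlowup
open Summit.ResolutionOfSingularities.ResolutionOfSingularities.Theorems.TightDefectClasses
open Summit.ResolutionOfSingularities.ResolutionOfSingularities.Theorems.ProximityCut
open Summit.ResolutionOfSingularities.ResolutionOfSingularities.Theorems.TightCut
open Summit.ResolutionOfSingularities.ResolutionOfSingularities.Theorems.HoleCut
open Summit.ResolutionOfSingularities.ResolutionOfSingularities.Theorems.ItineraryCutClasses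
open Summit.ResolutionOfSingularities.ResolutionOfSingularities.Theorems.TightDefectStrongWalks

namespace Summit.ResolutionOfSingularities.ResolutionOfSingularities.Theorems.WallCut

section Pollution

variable {σ : Type*} {K : Type*} [Field K] [Fintype σ] [DecidableEq σ] [DecidableEq K]

/-! ## §W2 THE POLLUTION LAW (KERNEL, model level) — the cleaning term is divisible by the new exceptional monomial

The model's `step` CLEANS the point transform (`deletePthPowers q`: it deletes the monomials `y^E` with `q ∣ E`).  The
deleted monomials are monomials OF THE POINT TRANSFORM, and every monomial of the point transform is divisible by the
new exceptional monomial `y^{r'}` (the tree's `newMult_le_of_mem_support_step` is this statement AFTER cleaning; the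
proof is the same).  Consequence used by the §W3 dictionary: a polluting exponent `E` has `q ∣ E_y` and `E_y ≥ r'_y`,
so `E_y ≥ q` at every new wall `y` (`r'_y ≥ 1`); on a δ-balanced stage (`r'_y = q − s` at both walls) the cleaning
term divided by `y^{r'}` lies in the ideal `(u^s v^s)` of the two walls — EXACTLY the ideal modulo which Kollár's
coefficient supports are read (K1a/K1b), in EVERY sub-critical cell and not only on the boundary line. [new; KERNEL] -/

/-- Before cleaning, every monomial of the point transform is divisible by the new exceptional monomial `y^{r'}`.
[folklore; the un-cleaned form of the tree's `newMult_le_of_mem_support_step`, same proof] [folklore] -/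
theorem newMult_le_of_coeff_pointTransform_ne_zero (q : ℕ) (j : σ) (b : σ → K) (hbj : b j = 0)
    (s : State σ K) {o : ℕ} (ho : ordZero s.F = o) (hr : ∀ d ∈ s.F.support, s.r ≤ d)
    {E : σ →₀ ℕ} (hE : coeff E (pointTransform q j b s) ≠ 0) : (step q j b s).r ≤ E := by
  have hdeg := le_degree_of_ordZero_eq s ho
  rw [pointTransform_eq_sum, coeff_sum] at hE
  obtain ⟨d, hd, hne⟩ := Finset.exists_ne_zero_of_sum_ne_zero hE
  have hr1 : (step q j b s).r = (s.r.update j (o - q)).filter (fun i => b i = 0) := newMult_eq q j b hbj s ho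
  rw [hr1, Finsupp.le_def]
  intro i
  rw [Finsupp.filter_apply, Finsupp.update_apply]
  by_cases hbi : b i = 0
  · rw [if_pos hbi]
    have heq : E i = chartExponent q j d i := apply_eq_of_coeff_translate_monomial_ne_zero b hbi hne
    rw [heq, chartExponent_apply]
    by_cases hij : i = j
    · rw [if_pos hij, if_pos hij]
      have := hdeg d hd
      omega
    · rw [if_neg hij, if_neg hij]
      exact Finsupp.le_def.mp (hr d hd) i
  · rw [if_neg hbi]
    exact Nat.zero_le _

/-- Hence a POLLUTING monomial (a `q`-th power exponent of the point transform — the part the cleaning removes) meets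
every new exceptional coordinate `y` (`r'_y ≥ 1`) with exponent `E_y ≥ q`. [new] [folklore] -/
theorem le_of_pollution (q : ℕ) (j : σ) (b : σ → K) (hbj : b j = 0) (s : State σ K) {o : ℕ}
    (ho : ordZero s.F = o) (hr : ∀ d ∈ s.F.support, s.r ≤ d) {E : σ →₀ ℕ}
    (hE : coeff E (pointTransform q j b s) ≠ 0) (hP : IsPthPowerExponent q E) (y : σ) (hy : 1 ≤ (step q j b s).r y) :
    q ≤ E y :=
  Nat.le_of_dvd (lt_of_lt_of_le Nat.one_pos
      (le_trans hy (Finsupp.le_def.mp (newMult_le_of_coeff_pointTransform_ne_zero q j b hbj s ho hr hE) y)))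
    ((isPthPowerExponent_iff q E).mp hP y)

end Pollution

section PollutionWalk

variable {K : Type} [Field K] [DecidableEq K] {q : ℕ} {s₀ : State (Fin 3) K}

/-- THE POLLUTION LAW ALONG A FORCED WALK from a root: every monomial of the point transform at move `t` is divisible
by `y^{r_{t+1}}`. [new] [folklore] -/
theorem walk_pollution (hroot : IsRoot q s₀) (W : ForcedWalk q s₀) (t : ℕ) {E : Fin 3 →₀ ℕ}
    (hE : coeff E (pointTransform q (W.j t) (W.b t) (W.st t)) ≠ 0) : (W.st (t + 1)).r ≤ E := by
  obtain ⟨o, ho, -⟩ := walk_nat hroot W t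
  rw [W.st_succ]
  exact newMult_le_of_coeff_pointTransform_ne_zero q (W.j t) (W.b t) (W.onExc t) (W.st t) ho (walk_r hroot W t) hE

/-- … so the monomials removed by the cleaning at move `t` have exponent `≥ q` at every wall of stage `t + 1`, and on a
δ-BALANCED stage (`r_{t+1} y + s = q` at the walls) exponent `≥ r_{t+1} y + s`: divided by the exceptional monomial
the cleaning term lies in `(y_{H¹}^s · y_{H²}^s)`. [new] [folklore] -/
theorem walk_pollution_balanced (hroot : IsRoot q s₀) (W : ForcedWalk q s₀) (t : ℕ) {E : Fin 3 →₀ ℕ}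
    (hE : coeff E (pointTransform q (W.j t) (W.b t) (W.st t)) ≠ 0) (hP : IsPthPowerExponent q E)
    {s : ℕ} (y : Fin 3) (hy : 1 ≤ (W.st (t + 1)).r y) (hbal : (W.st (t + 1)).r y + s = q) :
    (W.st (t + 1)).r y + s ≤ E y := by
  have h1 : q ≤ E y :=
    Nat.le_of_dvd (lt_of_lt_of_le Nat.one_pos (le_trans hy (Finsupp.le_def.mp (walk_pollution hroot W t hE) y)))
      ((isPthPowerExponent_iff q E).mp hP y)
  omega

end PollutionWalk

end Summit.ResolutionOfSingularities.ResolutionOfSingularities.Theorems.WallCut
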